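import Literature.MathematicalPhysics.QuantumFieldTheory.Balaban1983to89.T4TowerRateDischarge
import Literature.MathematicalPhysics.QuantumFieldTheory.Balaban1983to89.T4BetaReadOutLipschitz
import Literature.MathematicalPhysics.QuantumFieldTheory.Balaban1983to89.T4CurrencyMatching
import Summits.QuantumFields.BalabanUV.T4Continuum.Support.NE9LastCouplingBridge
import Summits.QuantumFields.BalabanUV.T4Continuum.Support.OutputRateResidual

/-!
# NE4ReadOutSocket — binder row NE4 (spine node U2, estimate NE4 = `T4CouplingMatching.ScaleShiftRate`) as ONE
# Summits-side statement: node U2's NE4 triple, its spine-currency output `InjectedRate` and the spine's `K`-uniform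
# `URateUpTo K`, each from the two U3 rows' Summits END theorems (row NE9: `NE9LastCouplingBridge`, row NE5:
# `OutputRateResidual`) composed with the node-U2 read-out (R), BY NAME, every conditional a displayed binder
# (cell `pub-balaban`, T⁴-continuum fan-out, `HOME/BINDER-OWNERS.md` row NE4, owner lineage t4-ne4-p1, generation 29)

HONEST FRAMING (T4-DAG PAGE 1).  The cell's T⁴ target is rung (B)+1: existence AND uniqueness of the ε → 0 limit of
gauge-invariant observables on a FIXED finite torus T⁴ — NOT infinite volume, NOT a mass gap, NOT the Clay problem.  The
spine estimate NE4 («η-rate of the full β_k», shape `T4CouplingMatching.ScaleShiftRate`; β¹-half `RemainderShiftRate` +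
`FadingMemory` of the coupling-history moduli) is NOT PRINTED in [Balaban1987RG1]–[Balaban1989LargeFieldII]: print bounds the
SIZE of the new term E^{(k+1)} of one renormalization step ([Balaban1988RG2Cluster] (1.36), (2.38), (2.41)), never a modulus
of continuity of the one-step map in the older terms (lineage record `t4/T4-EST-NE4-P1.md` §1 (S5); the map-between-spaces
formulation is set aside at [Balaban1989LargeFieldRG1] p. 262).  NE4 is NOT PROVED here: node U2 is DEPENDENT — its three
inputs are an INSTANCE of NE5 ∧ NE9 ∧ FadingMemory (node U3) composed with one printed-STRUCTURE read-out of
[Balaban1987RG1] (1.20)–(1.22) p. 264 (tree `T4BetaReadOutLipschitz.ne4_of_u3_on`), and NE5, NE9 are the cell's own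
estimates, NOT PRINTED, NOT PROVED (spine estimates proved: 0/9, unchanged by this module).  Nothing printed is asserted;
no «…» quotation is introduced (0 cite tags; the located print of every binder is in the imported leaves' docstrings).
`FlowStep.BetaPertH`, (B), (B^μ) do not occur and are NOT hidden: they live in the window `W` / the runs of whoever
instantiates.  HONEST DEPENDENCY (cell, verbatim): continuum YM on T⁴ ⇐ BetaPertH ∧ nine spine estimates (0/9 proved);
BetaPertH ⇐ (D1) ∧ (D4) ∧ CAP+tail; G-an2-4 gates asym, D1 and NE2/3/4.

WHAT THIS MODULE IS.  Both U3 rows now have Summits-side END statements: row NE9's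
`NE9LastCouplingBridge.ne9_and_fadingMemory_of_couplingTwoPoint` (p201771) concludes LITERALLY
`NE9 EA W κ (prodModuli ℓ fun _ => ν) ∧ FadingMemory (ℓ/ν) ν (prodModuli ℓ fun _ => ν)` with
`ℓ = 4·clipbar·B + pexbar + 4·lipbar·B·qTbar`, `ν = ω + 4·lipbar·B·τ̄` over an abstract `ClusterGeom` (no holomorphy in the
coupling, no radius, no margin); row NE5's `OutputRateResidual.ne5_at_of_entrywise_lip_nat` (p197255) concludes LITERALLY
`NE5 EA EB W κ θ₅ C₅` with `C₅ = (Λ₅(c₁/r₀ + δ₅) + B₅)(θ₅ − ω₅)/(θ₅ − (ω₅ + Λ₅c₅))`.  This leaf plugs BOTH into node U2 by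
name (the scratch socket of the lineage, `t4/b2b-balaban-t4-ne4-p1/g29/socket_u2_v11.lean`, re-cut to its END-theorem
sections), so that row NE4's booking «DEPENDENT = (R)∘{NE5, NE9}» is ONE build-checked statement per face:

* §1 `ne4_of_endNE9_endNE5` — THE ROW's TRIPLE at node U2: `ScaleShiftRate (cr·C₅·θ₅) θ₅ γ β ∧ HistLipschitz (cr·Λ(·+1)) γ β
  ∧ T4CouplingMatching.FadingMemory (cr·(ℓ/ν)·ν) ν (cr·Λ(·+1))`, `Λ = prodModuli ℓ (fun _ => ν)`, from row NE9's END binders,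
  row NE5's END binders for the READ-OUT FAMILY (`EA`, `EBfam b′`), `b′ ∈ ]0, γ]`, through a DATUM-INDEXED family of step
  models `Mf b′` with datum-free scalars (the datum-uniformity C-ne4p1-8), and (R) = `RepresentsA`/`RepresentsB` (printed
  STRUCTURE) + `ReadBoundedOn`/`ReadCovariantOn` on the classes (printed TYPE; kernel terms for probe recipes,
  `T4BetaReadOutLipschitz.Probes`) + the window-to-`W` embedding `hW`.
* §2 `injectedRate_of_endNE9_endNE5` — node U2's OUTPUT in the spine's currency, `T4CauchySum.InjectedRate
  (2(cr·C₅·θ₅)/(1 − ρ)) 0 ρ (fun K j ↦ disc (g K) (g (K+1)) j)`, by t4-ne9-p1's GAP-ONLY closure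
  `T4CurrencyMatching.injectedRate_of_runs_gap` (NO asymptotic-freedom lower bound at node U2): + the RG equations with
  history at every cutoff, the printed box, the infrared pin, the memory gap `ν < ρ < 1`, `θ₅ ≤ ρ`, and the window
  `cr·(ℓ/ν)·ν·(γ³/2)·ρ/(ρ − ν) ≤ (1 − ρ)/2`.
* §3 `uRateUpTo_of_endNE9_endNE5` — the spine's `K`-UNIFORM `URateUpTo K` (`T4TowerRateDischarge.uRateUpTo_of_nodes` with
  `hinj :=` §2): + node U1b (`LipBackground`, `PolyLipGrowth`), nodes U5/U6 (`LocalRate`, `GaugeDominated`), row NE5's END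
  binders for the TOWER PAIR (`EA`, `EB`) through one step model `M`, the target rate `θ′ > max ν ρ`.

WHAT REMAINS DISPLAYED AT NODE U2 after this leaf (its booking sheet, record §20(b)/§21(b), re-keyed): NOT PRINTED — row
NE9's majorant/two-point binders (`TwoPointKP`, `hCup`, `hTcup`, explicit-part modulus; PROOF-INTERIOR of (B) per row NE9)
and row NE5's walls W1 (entrywise = NE2 ∧ NE3, hence after G-an2-4) / W2 / W3 / W4 / MI-R; printed STRUCTURE — `hA`/`hB`,
`ScaleZeroFree`…`Factorises`, `hrepr`; printed TYPE, unprinted number — `cr` (`hr`/`hcov`); node U1/H3 — runs/box/pin;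
CONDITIONAL-CELL — (B)/(B^μ)/BetaPertH inside `W`; scalars — `ν < ρ`, the window, S `ω₅ + Λ₅c₅ < θ₅`, reach R.

ONE-CARRIER CONVENTION (cell GAPS C-ne4p1-9; the scratch socket's design since generation 13): the same
`EA : Functional C C.BgA` feeds the read-out (R) (the probe backgrounds of [Balaban1987RG1] p. 264) in §1–§2 and the spine's
torus slice in §3.  §2's output `InjectedRate … (disc of the runs)` is CARRIER-FREE, so an instantiation on two carriers uses
§2 on the read-out carrier and `T4TowerRateDischarge.uRateUpTo_of_nodes` on the torus carrier with its own NE9/NE5 instances;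
§3 is the one-carrier composition (both background sorts inside `C.BgA`).

WHAT IS PROVED: bookkeeping only (`subst` of three displayed abbreviations, one sign computation `0 ≤ C₅`, compositions
of the imported theorems BY NAME).  0 sorry; axioms ⊆ {propext, Classical.choice, Quot.sound}; imports the LANDED modules
`T4TowerRateDischarge`, `T4BetaReadOutLipschitz`, `T4CurrencyMatching`, `Support/NE9LastCouplingBridge` (p201771),
`Support/OutputRateResidual` (p197255) and modifies nothing of them.  NOT COVERED: any instance of a binder for Bałaban's
objects; NE2, NE3, NE5, NE9, BetaPertH, (B), (B^μ); the asymptotic-freedom route (`EventualLowerH`, tree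
`T4BetaReadOutLipschitz.injectedRate_of_u3_on`) — not restated.  Rung (B)+1 finite T⁴; NOT summit progress.
-/

namespace Summit.QuantumFields.BalabanUV.T4Continuum.NE4ReadOutSocket

open Literature.MathematicalPhysics.QuantumFieldTheory.Balaban1983to89
open FlowStep (HBeta RGEqH Box)
open T4OutputRate (Carriers Functional NE5 NE9 LipBackground DecayBound)
open T4CouplingMatching (disc ScaleShiftRate HistLipschitz)
open T4CauchySum (InjectedRate)
open T4EtaRateMin (Readings LocalRate)
open T4RateLiaison (GaugeDominated)
open T4TowerRateComposition (URateUpTo PolyLipGrowth)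
open T4TowerRateDischarge (uRateUpTo_of_nodes)
open T4BetaReadOut (Slice ReadOut RepresentsA RepresentsB)
open T4BetaReadOutLipschitz (ReadBoundedOn ReadCovariantOn ne4_of_u3_on)
open T4FlagMemory (extd)
open T4HistoryLipschitzRecursion (prodModuli ScaleZeroFree AdmissibleTerms AdmRestrict ChannelAdditive ChannelStepSum
  ChannelSizeAtStepNN)
open T4HistoryLipschitzOuter (Factorises)
open T4HistoryLipschitzActivity (ClusterGeom)
open T4HistoryLipschitzSegment (TwoPointKP)
open T4InputCauchyRateData (StepModel)
open T4OperatorRateLiaison (EntrywiseRate)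
open NE9LastCouplingBridge (ne9_and_fadingMemory_of_couplingTwoPoint)
open OutputRateResidual (ne5_at_of_entrywise_lip_nat)

variable {C : Carriers} {ι X : Type}

/-! ## §0 The sign of row NE5's explicit constant -/

/-- Row NE5's explicit constant `C₅ = (Λ₅(c₁/r₀ + δ₅) + B₅)(θ₅ − ω₅)/(θ₅ − (ω₅ + Λ₅c₅))` is nonnegative under the END
theorem's own sign binders and its smallness S `ω₅ + Λ₅c₅ < θ₅`. [folklore] -/
theorem ne5Const_nonneg {Λ₅ c₁ r₀ δ₅ θ₅ c₅ ω₅ B₅ : ℝ} (hΛ₅ : 0 ≤ Λ₅) (hδ₅ : 0 ≤ δ₅) (hr₀ : 0 < r₀) (hc₁ : 0 ≤ c₁)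
    (hc₅ : 0 ≤ c₅) (hB₅ : 0 ≤ B₅) (hsmall5 : ω₅ + Λ₅ * c₅ < θ₅) :
    0 ≤ (Λ₅ * (c₁ / r₀ + δ₅) + B₅) * (θ₅ - ω₅) / (θ₅ - (ω₅ + Λ₅ * c₅)) := by
  have h1 : 0 ≤ Λ₅ * (c₁ / r₀ + δ₅) + B₅ := add_nonneg (mul_nonneg hΛ₅ (add_nonneg (div_nonneg hc₁ hr₀.le) hδ₅)) hB₅
  have h2 : 0 ≤ Λ₅ * c₅ := mul_nonneg hΛ₅ hc₅
  exact div_nonneg (mul_nonneg h1 (by linarith)) (by linarith)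

/-! ## §1 The row's triple at node U2 from the two END theorems and the read-out (R) -/

/-- **ROW NE4 — NODE U2's TRIPLE FROM ROW NE9's AND ROW NE5's END THEOREMS AND THE READ-OUT (R), BY NAME.**  Binders:
(NE9-END) those of `NE9LastCouplingBridge.ne9_and_fadingMemory_of_couplingTwoPoint` over an abstract cluster geometry `G`,
run-A term family `EA` on backgrounds `C.BgA`, verbatim (renamed only where node U2 uses the same letter: read-out
`ρT`, channel index `ιc`, KP size functions `aP`/`dP`, `hKP`/`hpinB`/`hρT`/`hB0`); the modulus constant `ℓ` and the memory
rate `ν` abbreviated by displayed equations `hℓ`/`hν`.  (NE5-END, read-out family) those of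
`OutputRateResidual.ne5_at_of_entrywise_lip_nat` for the pair (`EA`, `EBfam b′`) at every datum `b′ ∈ ]0, γ]` through a
datum-indexed family of step models `Mf b′` — MI-R `hrAf`/`hrBf`/`hbasef`, W2 `hlipf`, decay `hdA`/`hdBf`, W1 entrywise
`hentf`/`hunit`/`hflf`, W4 `hinsf`, W3 `hdampf` — with datum-FREE scalars, reach `hnear`, first scales `hfirst`,
smallness S `hsmall5`; the constant `C₅` abbreviated by `hC₅`.  (R) `hW`, `hA`, `hB`, `h𝒜A`, `h𝒜B`, `hr`, `hcov`, `hcr`.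
Conclusion = `T4BetaReadOutLipschitz.ne4_of_u3_on` on these: node U2's NE4 triple with constants `cr·C₅·θ₅`,
`cr·Λ(k+1)`, `cr·(ℓ/ν)·ν` at the rates `θ₅` (scale shift) and `ν` (memory). [folklore] -/
theorem ne4_of_endNE9_endNE5 (G : ClusterGeom C) {Pot : Type*} [NormedAddCommGroup Pot] [NormedSpace ℂ Pot]
    {S Hist : Type*} [Fintype S] [NormedAddCommGroup Hist] [NormedSpace ℂ Hist] (Mf : ℝ → StepModel C (S → ℂ) Hist)
    {ιc : Type} {EA : Functional C C.BgA} {W : Set (ℕ → ℝ)} {Adm : Set (C.BgA → C.Dom → ℝ)}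
    {T : ℕ → (ℕ → ℝ) → (C.BgA → C.Dom → ℝ) → ιc → ℝ} {Ψ : ℕ → ℝ → (ιc → ℝ) → C.BgA → C.Dom → ℝ}
    {act : ℕ → ℝ → C.BgA → Pot → G.P → ℂ} {𝒜 : ℕ → Set Pot} {n : ℕ → ℝ → C.BgA → G.P → ℝ} {lip clip : ℕ → ℝ}
    {aP dP : G.P → ℝ} {δ : C.Dom → ℝ} {κ B lipbar clipbar pexbar qTbar τbar ω ℓ ν : ℝ} {wt : ℕ → ιc → ℝ}
    {τ : ℕ → ℕ → ℝ} {pex qT : ℕ → ℝ} (ρT : ℕ → (ιc → ℝ) → Pot) (expl : ℕ → ℝ → C.BgA → C.Dom → ℝ)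
    -- ===== row NE9's END theorem: the binders of `ne9_and_fadingMemory_of_couplingTwoPoint`, verbatim =====
    (h0 : ScaleZeroFree EA W) (hAdm : AdmissibleTerms EA W Adm) (hres : AdmRestrict Adm) (hadd : ChannelAdditive Adm T)
    (hsum : ChannelStepSum Adm T) (hstep : ChannelSizeAtStepNN Adm T κ wt τ) (hfac : Factorises EA W T Ψ)
    (hclip0 : ∀ k, 0 ≤ clip k)
    (hCup : ∀ g ∈ W, ∀ g' ∈ W, ∀ (k : ℕ) (U : C.BgA) (X : C.Dom), C.scale X = k + 1 → ∀ Q ∈ 𝒜 k, ∀ γ ∈ G.vol X,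
      ‖act k (g k) U Q γ‖ ≤ n k (g' k) U γ ∧
        ‖act k (g k) U Q γ - act k (g' k) U Q γ‖ ≤ clip k * |g k - g' k| * n k (g' k) U γ)
    (hqT0 : ∀ k, 0 ≤ qT k)
    (hTcup : ∀ g ∈ W, ∀ g' ∈ W, ∀ (k : ℕ) (y : ιc), |T k g (EA g) y - T k g' (EA g) y| ≤ wt k y * (qT k * |g k - g' k|))
    (hrepr : ∀ (k : ℕ) (s : ℝ) (P : ιc → ℝ) (U : C.BgA) (X : C.Dom),
      Ψ k s P U X = (G.newTerm act k s U X (ρT k P)).re + expl k s U X)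
    (hexpl : ∀ g ∈ W, ∀ g' ∈ W, ∀ (k : ℕ) (U : C.BgA) (X : C.Dom), C.scale X = k + 1 →
      |expl k (g k) U X - expl k (g' k) U X| ≤ Real.exp (-(κ * C.d X)) * (pex k * |g k - g' k|))
    (hclipb : ∀ k, clip k ≤ clipbar) (hpexb : ∀ k, pex k ≤ pexbar) (hpexbar : 0 ≤ pexbar) (hqTb : ∀ k, qT k ≤ qTbar)
    (hKP : TwoPointKP G W act 𝒜 n lip aP dP) (hdec : G.DecayExtract δ dP) (hpinB : G.PinBudget aP δ (fun _ => B) κ)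
    (hρT : ∀ (k : ℕ) (P P' : ιc → ℝ) (M : ℝ), (∀ y, |P y - P' y| ≤ wt k y * M) → ‖ρT k P - ρT k P'‖ ≤ M)
    (hocc : ∀ g ∈ W, ∀ g' ∈ W, ∀ k : ℕ, ρT k (T k g' (EA g)) ∈ 𝒜 k) (hB0 : 0 ≤ B)
    (hlipb : ∀ k, lip k ≤ lipbar) (hτbar : 0 ≤ τbar) (hω : 0 ≤ ω) (hpos : 0 < ω + 4 * lipbar * B * τbar)
    (hτ : ∀ k j, j ≤ k → 0 ≤ τ k j ∧ τ k j ≤ τbar * ω ^ (k - j))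
    (hℓ : 4 * clipbar * B + pexbar + 4 * lipbar * B * qTbar = ℓ) (hν : ω + 4 * lipbar * B * τbar = ν)
    -- ===== row NE5's END theorem for the read-out family (`EA`, `EBfam b′`) through `Mf b′`, datum-free scalars =====
    {EBfam : ℝ → Functional C C.BgB} {γ Λ₅ EA₀ E₀ c₁ r₀ δ₅ θ₁ θ₅ c₅ ω₅ ρ₀ B₅ C₅ : ℝ} {rf : ℕ → S → ℝ} {k₅ : ℕ}
    (hdA : DecayBound EA W EA₀ κ) (hunit : ∀ k s, rf k s ≤ θ₁ ^ k) (hr₀ : 0 < r₀) (hc₁ : 0 ≤ c₁)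
    (hrAf : ∀ b', 0 < b' → b' ≤ γ → (Mf b').RepresentsA EA W)
    (hrBf : ∀ b', 0 < b' → b' ≤ γ → (Mf b').RepresentsB (EBfam b') W)
    (hbasef : ∀ b', 0 < b' → b' ≤ γ → (Mf b').InBase (EBfam b') W)
    (hlipf : ∀ b', 0 < b' → b' ≤ γ → (Mf b').DataLipschitz W κ Λ₅ ρ₀)
    (hdBf : ∀ b', 0 < b' → b' ≤ γ → DecayBound (EBfam b') W E₀ κ)
    (hentf : ∀ b', 0 < b' → b' ≤ γ → EntrywiseRate (Mf b') W c₁ rf)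
    (hflf : ∀ b', 0 < b' → b' ≤ γ → ∀ k, r₀ ≤ (Mf b').rOp k)
    (hinsf : ∀ b', 0 < b' → b' ≤ γ → (Mf b').InsertionRate W κ E₀ δ₅ θ₁)
    (hdampf : ∀ b', 0 < b' → b' ≤ γ → (Mf b').InsertionDampedNat W κ c₅ ω₅)
    (hΛ₅ : 0 ≤ Λ₅) (hδ₅ : 0 ≤ δ₅) (hθ₁ : 0 ≤ θ₁) (hθ₁₅ : θ₁ ≤ θ₅) (hθ₅1 : θ₅ ≤ 1) (hc₅ : 0 ≤ c₅) (hω₅ : 0 < ω₅)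
    (hnear : (c₁ / r₀ + δ₅) * θ₁ ^ k₅ + c₅ * (EA₀ + E₀) / (1 - ω₅) ≤ ρ₀) (hB₅ : 0 ≤ B₅)
    (hfirst : ∀ k < k₅, EA₀ + E₀ ≤ B₅ * θ₁ ^ k) (hsmall5 : ω₅ + Λ₅ * c₅ < θ₅)
    (hC₅ : (Λ₅ * (c₁ / r₀ + δ₅) + B₅) * (θ₅ - ω₅) / (θ₅ - (ω₅ + Λ₅ * c₅)) = C₅)
    -- ===== node U2's read-out (R) =====
    {𝒜A : Set (Slice C C.BgA)} {𝒜B : Set (Slice C C.BgB)} {rA : ReadOut C C.BgA} {rB : ReadOut C C.BgB} {β : HBeta}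
    {cr : ℝ} (hW : ∀ k (v : Fin (k + 1) → ℝ), v ∈ Box γ k → extd v ∈ W)
    (hA : RepresentsA EA rA γ β) (hB : RepresentsB EBfam rB γ β)
    (h𝒜A : ∀ g' ∈ W, EA g' ∈ 𝒜A) (h𝒜B : ∀ b', 0 < b' → b' ≤ γ → ∀ g' ∈ W, EBfam b' g' ∈ 𝒜B)
    (hr : ReadBoundedOn 𝒜A rA κ cr) (hcov : ReadCovariantOn 𝒜A 𝒜B rA rB κ cr) (hcr : 0 ≤ cr) :
    ScaleShiftRate (cr * C₅ * θ₅) θ₅ γ β ∧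
      HistLipschitz (fun k i => cr * prodModuli ℓ (fun _ => ν) (k + 1) i) γ β ∧
        T4CouplingMatching.FadingMemory (cr * (ℓ / ν) * ν) ν (fun k i => cr * prodModuli ℓ (fun _ => ν) (k + 1) i) := by
  subst hℓ hν hC₅
  have hK := ne9_and_fadingMemory_of_couplingTwoPoint G ρT expl h0 hAdm hres hadd hsum hstep hfac hclip0 hCup hqT0 hTcup
    hrepr hexpl hclipb hpexb hpexbar hqTb hKP hdec hpinB hρT hocc hB0 hlipb hτbar hω hpos hτ
  exact ne4_of_u3_on hW
    (fun b' hb hbγ => ne5_at_of_entrywise_lip_nat (Mf b') (hrAf b' hb hbγ) (hrBf b' hb hbγ) (hbasef b' hb hbγ)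
      (hlipf b' hb hbγ) hdA (hdBf b' hb hbγ) (hentf b' hb hbγ) hunit (hflf b' hb hbγ) hr₀ hc₁ (hinsf b' hb hbγ)
      (hdampf b' hb hbγ) hΛ₅ hδ₅ hθ₁ hθ₁₅ hθ₅1 hc₅ hω₅ hnear hB₅ hfirst hsmall5)
    hK.1 hK.2 hA hB h𝒜A h𝒜B hr hcov hcr

/-! ## §2 Node U2's output in the spine's currency (gap route, no asymptotic-freedom input) -/

/-- **ROW NE4 — NODE U2's OUTPUT `InjectedRate` FROM THE TWO END THEOREMS, (R) AND THE RUNS, BY NAME.**  §1's binders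
plus node U1/H3's runs of (0.20) with history (`hrun`), the printed box (`hbox`), the infrared pin (`hpin`), the rates
`θ₅ ≤ ρ`, memory gap `ν < ρ`, `0 < ρ < 1`, `0 ≤ γ`, and the window `hsmall`; conclusion = t4-ne9-p1's GAP-ONLY closure
`T4CurrencyMatching.injectedRate_of_runs_gap` on §1's triple: `InjectedRate (2(cr·C₅·θ₅)/(1 − ρ)) 0 ρ (disc of the runs)` —
the binder `hinj` of `T4TowerRateDischarge.uRateUpTo_of_nodes` and of the sibling lineage's continuum-coupling chain
(`T4ScaleMatchingRate`, `T4LambdaMatching`, `T4BareLambdaRate`).  NO `EventualLowerH`, NO `0 < b`. [folklore] -/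
theorem injectedRate_of_endNE9_endNE5 (G : ClusterGeom C) {Pot : Type*} [NormedAddCommGroup Pot] [NormedSpace ℂ Pot]
    {S Hist : Type*} [Fintype S] [NormedAddCommGroup Hist] [NormedSpace ℂ Hist] (Mf : ℝ → StepModel C (S → ℂ) Hist)
    {ιc : Type} {EA : Functional C C.BgA} {W : Set (ℕ → ℝ)} {Adm : Set (C.BgA → C.Dom → ℝ)}
    {T : ℕ → (ℕ → ℝ) → (C.BgA → C.Dom → ℝ) → ιc → ℝ} {Ψ : ℕ → ℝ → (ιc → ℝ) → C.BgA → C.Dom → ℝ}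
    {act : ℕ → ℝ → C.BgA → Pot → G.P → ℂ} {𝒜 : ℕ → Set Pot} {n : ℕ → ℝ → C.BgA → G.P → ℝ} {lip clip : ℕ → ℝ}
    {aP dP : G.P → ℝ} {δ : C.Dom → ℝ} {κ B lipbar clipbar pexbar qTbar τbar ω ℓ ν : ℝ} {wt : ℕ → ιc → ℝ}
    {τ : ℕ → ℕ → ℝ} {pex qT : ℕ → ℝ} (ρT : ℕ → (ιc → ℝ) → Pot) (expl : ℕ → ℝ → C.BgA → C.Dom → ℝ)
    (h0 : ScaleZeroFree EA W) (hAdm : AdmissibleTerms EA W Adm) (hres : AdmRestrict Adm) (hadd : ChannelAdditive Adm T)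
    (hsum : ChannelStepSum Adm T) (hstep : ChannelSizeAtStepNN Adm T κ wt τ) (hfac : Factorises EA W T Ψ)
    (hclip0 : ∀ k, 0 ≤ clip k)
    (hCup : ∀ g ∈ W, ∀ g' ∈ W, ∀ (k : ℕ) (U : C.BgA) (X : C.Dom), C.scale X = k + 1 → ∀ Q ∈ 𝒜 k, ∀ γ ∈ G.vol X,
      ‖act k (g k) U Q γ‖ ≤ n k (g' k) U γ ∧
        ‖act k (g k) U Q γ - act k (g' k) U Q γ‖ ≤ clip k * |g k - g' k| * n k (g' k) U γ)
    (hqT0 : ∀ k, 0 ≤ qT k)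
    (hTcup : ∀ g ∈ W, ∀ g' ∈ W, ∀ (k : ℕ) (y : ιc), |T k g (EA g) y - T k g' (EA g) y| ≤ wt k y * (qT k * |g k - g' k|))
    (hrepr : ∀ (k : ℕ) (s : ℝ) (P : ιc → ℝ) (U : C.BgA) (X : C.Dom),
      Ψ k s P U X = (G.newTerm act k s U X (ρT k P)).re + expl k s U X)
    (hexpl : ∀ g ∈ W, ∀ g' ∈ W, ∀ (k : ℕ) (U : C.BgA) (X : C.Dom), C.scale X = k + 1 →
      |expl k (g k) U X - expl k (g' k) U X| ≤ Real.exp (-(κ * C.d X)) * (pex k * |g k - g' k|))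
    (hclipb : ∀ k, clip k ≤ clipbar) (hpexb : ∀ k, pex k ≤ pexbar) (hpexbar : 0 ≤ pexbar) (hqTb : ∀ k, qT k ≤ qTbar)
    (hKP : TwoPointKP G W act 𝒜 n lip aP dP) (hdec : G.DecayExtract δ dP) (hpinB : G.PinBudget aP δ (fun _ => B) κ)
    (hρT : ∀ (k : ℕ) (P P' : ιc → ℝ) (M : ℝ), (∀ y, |P y - P' y| ≤ wt k y * M) → ‖ρT k P - ρT k P'‖ ≤ M)
    (hocc : ∀ g ∈ W, ∀ g' ∈ W, ∀ k : ℕ, ρT k (T k g' (EA g)) ∈ 𝒜 k) (hB0 : 0 ≤ B)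
    (hlipb : ∀ k, lip k ≤ lipbar) (hτbar : 0 ≤ τbar) (hω : 0 ≤ ω) (hpos : 0 < ω + 4 * lipbar * B * τbar)
    (hτ : ∀ k j, j ≤ k → 0 ≤ τ k j ∧ τ k j ≤ τbar * ω ^ (k - j))
    (hℓ : 4 * clipbar * B + pexbar + 4 * lipbar * B * qTbar = ℓ) (hν : ω + 4 * lipbar * B * τbar = ν)
    {EBfam : ℝ → Functional C C.BgB} {γ Λ₅ EA₀ E₀ c₁ r₀ δ₅ θ₁ θ₅ c₅ ω₅ ρ₀ B₅ C₅ : ℝ} {rf : ℕ → S → ℝ} {k₅ : ℕ}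
    (hdA : DecayBound EA W EA₀ κ) (hunit : ∀ k s, rf k s ≤ θ₁ ^ k) (hr₀ : 0 < r₀) (hc₁ : 0 ≤ c₁)
    (hrAf : ∀ b', 0 < b' → b' ≤ γ → (Mf b').RepresentsA EA W)
    (hrBf : ∀ b', 0 < b' → b' ≤ γ → (Mf b').RepresentsB (EBfam b') W)
    (hbasef : ∀ b', 0 < b' → b' ≤ γ → (Mf b').InBase (EBfam b') W)
    (hlipf : ∀ b', 0 < b' → b' ≤ γ → (Mf b').DataLipschitz W κ Λ₅ ρ₀)
    (hdBf : ∀ b', 0 < b' → b' ≤ γ → DecayBound (EBfam b') W E₀ κ)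
    (hentf : ∀ b', 0 < b' → b' ≤ γ → EntrywiseRate (Mf b') W c₁ rf)
    (hflf : ∀ b', 0 < b' → b' ≤ γ → ∀ k, r₀ ≤ (Mf b').rOp k)
    (hinsf : ∀ b', 0 < b' → b' ≤ γ → (Mf b').InsertionRate W κ E₀ δ₅ θ₁)
    (hdampf : ∀ b', 0 < b' → b' ≤ γ → (Mf b').InsertionDampedNat W κ c₅ ω₅)
    (hΛ₅ : 0 ≤ Λ₅) (hδ₅ : 0 ≤ δ₅) (hθ₁ : 0 ≤ θ₁) (hθ₁₅ : θ₁ ≤ θ₅) (hθ₅1 : θ₅ ≤ 1) (hc₅ : 0 ≤ c₅) (hω₅ : 0 < ω₅)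
    (hnear : (c₁ / r₀ + δ₅) * θ₁ ^ k₅ + c₅ * (EA₀ + E₀) / (1 - ω₅) ≤ ρ₀) (hB₅ : 0 ≤ B₅)
    (hfirst : ∀ k < k₅, EA₀ + E₀ ≤ B₅ * θ₁ ^ k) (hsmall5 : ω₅ + Λ₅ * c₅ < θ₅)
    (hC₅ : (Λ₅ * (c₁ / r₀ + δ₅) + B₅) * (θ₅ - ω₅) / (θ₅ - (ω₅ + Λ₅ * c₅)) = C₅)
    {𝒜A : Set (Slice C C.BgA)} {𝒜B : Set (Slice C C.BgB)} {rA : ReadOut C C.BgA} {rB : ReadOut C C.BgB} {β : HBeta}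
    {cr : ℝ} (hW : ∀ k (v : Fin (k + 1) → ℝ), v ∈ Box γ k → extd v ∈ W)
    (hA : RepresentsA EA rA γ β) (hB : RepresentsB EBfam rB γ β)
    (h𝒜A : ∀ g' ∈ W, EA g' ∈ 𝒜A) (h𝒜B : ∀ b', 0 < b' → b' ≤ γ → ∀ g' ∈ W, EBfam b' g' ∈ 𝒜B)
    (hr : ReadBoundedOn 𝒜A rA κ cr) (hcov : ReadCovariantOn 𝒜A 𝒜B rA rB κ cr) (hcr : 0 ≤ cr)
    -- ===== node U1/H3's runs, the rates and the window =====
    {ρ : ℝ} (g : ℕ → ℕ → ℝ) (gIR : ℝ) (hθ₅ρ : θ₅ ≤ ρ) (hνρ : ν < ρ) (hρ0 : 0 < ρ) (hρ1 : ρ < 1) (hγ : 0 ≤ γ)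
    (hrun : ∀ K, RGEqH K β (g K)) (hbox : ∀ K i, i ≤ K → 0 < g K i ∧ g K i ≤ γ) (hpin : ∀ K, g K K = gIR)
    (hsmall : cr * (ℓ / ν) * ν * (γ ^ 3 / 2) * (ρ / (ρ - ν)) ≤ (1 - ρ) / 2) :
    InjectedRate (2 * (cr * C₅ * θ₅) / (1 - ρ)) 0 ρ (fun K j => disc (g K) (g (K + 1)) j) := by
  subst hℓ hν hC₅
  have hK := ne9_and_fadingMemory_of_couplingTwoPoint G ρT expl h0 hAdm hres hadd hsum hstep hfac hclip0 hCup hqT0 hTcup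
    hrepr hexpl hclipb hpexb hpexbar hqTb hKP hdec hpinB hρT hocc hB0 hlipb hτbar hω hpos hτ
  obtain ⟨hS, hL, hM⟩ := ne4_of_endNE9_endNE5 G Mf ρT expl h0 hAdm hres hadd hsum hstep hfac hclip0 hCup hqT0 hTcup hrepr
    hexpl hclipb hpexb hpexbar hqTb hKP hdec hpinB hρT hocc hB0 hlipb hτbar hω hpos hτ rfl rfl hdA hunit hr₀ hc₁ hrAf hrBf
    hbasef hlipf hdBf hentf hflf hinsf hdampf hΛ₅ hδ₅ hθ₁ hθ₁₅ hθ₅1 hc₅ hω₅ hnear hB₅ hfirst hsmall5 rfl hW hA hB h𝒜A h𝒜B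
    hr hcov hcr
  exact T4CurrencyMatching.injectedRate_of_runs_gap g gIR hρ0 hρ1 (hθ₁.trans hθ₁₅) hθ₅ρ hpos.le hνρ
    (mul_nonneg (mul_nonneg hcr (ne5Const_nonneg hΛ₅ hδ₅ hr₀ hc₁ hc₅ hB₅ hsmall5)) (hθ₁.trans hθ₁₅))
    (mul_nonneg (mul_nonneg hcr (T4BetaReadOut.fadingMemory_const_nonneg hK.2)) hpos.le) hγ hrun hbox hpin hS hL hM hsmall

/-! ## §3 The spine's `K`-uniform term-wise matching with node U2 fed by the two END theorems -/

/-- **ROW NE4 IN THE SPINE — `URateUpTo K`, `K`-UNIFORM, WITH NODE U2 FED BY ROW NE9's AND ROW NE5's END THEOREMS.**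
`T4TowerRateDischarge.uRateUpTo_of_nodes` with: `h9`/`hΛ` := row NE9's END theorem (binders as in §1); `h5` := row NE5's
END theorem for the TOWER PAIR (`EA`, `EB`) through ONE step model `M` (MI-R `hrA`/`hrB`/`hbase`, W2 `hlip5`, decay `hdB`,
W1 `hent`/`hfl`, W4 `hins`, W3 `hdamp`; scalars shared with the read-out family); `hinj` := §2; node U1b `hU`/`hG`/`hP`;
nodes U5/U6 `hloc`/`hgd`; the runs in `W` (`hgA`/`hgB`); target rate `θ′ > max ν ρ`, `θ₅, θ₃ ≤ θ′`.  Constant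
`a + (ℓ/ν)·(γ³·2(cr·C₅·θ₅)/(1 − ρ))·θ′/(θ′ − max ν ρ) + C₅`, `a ≥ 0` from the spine's bracket.  One-carrier composition
(header: ONE-CARRIER CONVENTION; on two carriers use §2 + `uRateUpTo_of_nodes`).  What node U2 displays
after this: (R), node U1b, nodes U5/U6, node U1/H3's runs/box/pin, the memory gap, the window, `θ′` — and the two rows'
END binders (NOT PRINTED; owners t4-ne9-p1, t4-ne5-p1). [folklore] -/
theorem uRateUpTo_of_endNE9_endNE5 (G : ClusterGeom C) {Pot : Type*} [NormedAddCommGroup Pot] [NormedSpace ℂ Pot]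
    {S Hist : Type*} [Fintype S] [NormedAddCommGroup Hist] [NormedSpace ℂ Hist] (M : StepModel C (S → ℂ) Hist)
    (Mf : ℝ → StepModel C (S → ℂ) Hist) {ιc : Type} {EA : Functional C C.BgA} {W : Set (ℕ → ℝ)}
    {Adm : Set (C.BgA → C.Dom → ℝ)} {T : ℕ → (ℕ → ℝ) → (C.BgA → C.Dom → ℝ) → ιc → ℝ}
    {Ψ : ℕ → ℝ → (ιc → ℝ) → C.BgA → C.Dom → ℝ} {act : ℕ → ℝ → C.BgA → Pot → G.P → ℂ} {𝒜 : ℕ → Set Pot}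
    {n : ℕ → ℝ → C.BgA → G.P → ℝ} {lip clip : ℕ → ℝ} {aP dP : G.P → ℝ} {δ : C.Dom → ℝ}
    {κ B lipbar clipbar pexbar qTbar τbar ω ℓ ν : ℝ} {wt : ℕ → ιc → ℝ} {τ : ℕ → ℕ → ℝ} {pex qT : ℕ → ℝ}
    (ρT : ℕ → (ιc → ℝ) → Pot) (expl : ℕ → ℝ → C.BgA → C.Dom → ℝ)
    -- ===== row NE9's END theorem =====
    (h0 : ScaleZeroFree EA W) (hAdm : AdmissibleTerms EA W Adm) (hres : AdmRestrict Adm) (hadd : ChannelAdditive Adm T)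
    (hsum : ChannelStepSum Adm T) (hstep : ChannelSizeAtStepNN Adm T κ wt τ) (hfac : Factorises EA W T Ψ)
    (hclip0 : ∀ k, 0 ≤ clip k)
    (hCup : ∀ g ∈ W, ∀ g' ∈ W, ∀ (k : ℕ) (U : C.BgA) (X : C.Dom), C.scale X = k + 1 → ∀ Q ∈ 𝒜 k, ∀ γ ∈ G.vol X,
      ‖act k (g k) U Q γ‖ ≤ n k (g' k) U γ ∧
        ‖act k (g k) U Q γ - act k (g' k) U Q γ‖ ≤ clip k * |g k - g' k| * n k (g' k) U γ)
    (hqT0 : ∀ k, 0 ≤ qT k)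
    (hTcup : ∀ g ∈ W, ∀ g' ∈ W, ∀ (k : ℕ) (y : ιc), |T k g (EA g) y - T k g' (EA g) y| ≤ wt k y * (qT k * |g k - g' k|))
    (hrepr : ∀ (k : ℕ) (s : ℝ) (P : ιc → ℝ) (U : C.BgA) (X : C.Dom),
      Ψ k s P U X = (G.newTerm act k s U X (ρT k P)).re + expl k s U X)
    (hexpl : ∀ g ∈ W, ∀ g' ∈ W, ∀ (k : ℕ) (U : C.BgA) (X : C.Dom), C.scale X = k + 1 →
      |expl k (g k) U X - expl k (g' k) U X| ≤ Real.exp (-(κ * C.d X)) * (pex k * |g k - g' k|))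
    (hclipb : ∀ k, clip k ≤ clipbar) (hpexb : ∀ k, pex k ≤ pexbar) (hpexbar : 0 ≤ pexbar) (hqTb : ∀ k, qT k ≤ qTbar)
    (hKP : TwoPointKP G W act 𝒜 n lip aP dP) (hdec : G.DecayExtract δ dP) (hpinB : G.PinBudget aP δ (fun _ => B) κ)
    (hρT : ∀ (k : ℕ) (P P' : ιc → ℝ) (M : ℝ), (∀ y, |P y - P' y| ≤ wt k y * M) → ‖ρT k P - ρT k P'‖ ≤ M)
    (hocc : ∀ g ∈ W, ∀ g' ∈ W, ∀ k : ℕ, ρT k (T k g' (EA g)) ∈ 𝒜 k) (hB0 : 0 ≤ B)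
    (hlipb : ∀ k, lip k ≤ lipbar) (hτbar : 0 ≤ τbar) (hω : 0 ≤ ω) (hpos : 0 < ω + 4 * lipbar * B * τbar)
    (hτ : ∀ k j, j ≤ k → 0 ≤ τ k j ∧ τ k j ≤ τbar * ω ^ (k - j))
    (hℓ : 4 * clipbar * B + pexbar + 4 * lipbar * B * qTbar = ℓ) (hν : ω + 4 * lipbar * B * τbar = ν)
    -- ===== row NE5's END theorem: tower pair (`EA`, `EB`) through `M`, read-out family through `Mf b′` =====
    {EB : Functional C C.BgB} {EBfam : ℝ → Functional C C.BgB}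
    {γ Λ₅ EA₀ E₀ c₁ r₀ δ₅ θ₁ θ₅ c₅ ω₅ ρ₀ B₅ C₅ : ℝ} {rf : ℕ → S → ℝ} {k₅ : ℕ}
    (hrA : M.RepresentsA EA W) (hrB : M.RepresentsB EB W) (hbase : M.InBase EB W) (hlip5 : M.DataLipschitz W κ Λ₅ ρ₀)
    (hdA : DecayBound EA W EA₀ κ) (hdB : DecayBound EB W E₀ κ) (hent : EntrywiseRate M W c₁ rf)
    (hunit : ∀ k s, rf k s ≤ θ₁ ^ k) (hfl : ∀ k, r₀ ≤ M.rOp k) (hr₀ : 0 < r₀) (hc₁ : 0 ≤ c₁)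
    (hins : M.InsertionRate W κ E₀ δ₅ θ₁) (hdamp : M.InsertionDampedNat W κ c₅ ω₅)
    (hrAf : ∀ b', 0 < b' → b' ≤ γ → (Mf b').RepresentsA EA W)
    (hrBf : ∀ b', 0 < b' → b' ≤ γ → (Mf b').RepresentsB (EBfam b') W)
    (hbasef : ∀ b', 0 < b' → b' ≤ γ → (Mf b').InBase (EBfam b') W)
    (hlipf : ∀ b', 0 < b' → b' ≤ γ → (Mf b').DataLipschitz W κ Λ₅ ρ₀)
    (hdBf : ∀ b', 0 < b' → b' ≤ γ → DecayBound (EBfam b') W E₀ κ)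
    (hentf : ∀ b', 0 < b' → b' ≤ γ → EntrywiseRate (Mf b') W c₁ rf)
    (hflf : ∀ b', 0 < b' → b' ≤ γ → ∀ k, r₀ ≤ (Mf b').rOp k)
    (hinsf : ∀ b', 0 < b' → b' ≤ γ → (Mf b').InsertionRate W κ E₀ δ₅ θ₁)
    (hdampf : ∀ b', 0 < b' → b' ≤ γ → (Mf b').InsertionDampedNat W κ c₅ ω₅)
    (hΛ₅ : 0 ≤ Λ₅) (hδ₅ : 0 ≤ δ₅) (hθ₁ : 0 ≤ θ₁) (hθ₁₅ : θ₁ ≤ θ₅) (hθ₅1 : θ₅ ≤ 1) (hc₅ : 0 ≤ c₅) (hω₅ : 0 < ω₅)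
    (hnear : (c₁ / r₀ + δ₅) * θ₁ ^ k₅ + c₅ * (EA₀ + E₀) / (1 - ω₅) ≤ ρ₀) (hB₅ : 0 ≤ B₅)
    (hfirst : ∀ k < k₅, EA₀ + E₀ ≤ B₅ * θ₁ ^ k) (hsmall5 : ω₅ + Λ₅ * c₅ < θ₅)
    (hC₅ : (Λ₅ * (c₁ / r₀ + δ₅) + B₅) * (θ₅ - ω₅) / (θ₅ - (ω₅ + Λ₅ * c₅)) = C₅)
    -- ===== node U2's read-out (R) =====
    {𝒜A : Set (Slice C C.BgA)} {𝒜B : Set (Slice C C.BgB)} {rA : ReadOut C C.BgA} {rB : ReadOut C C.BgB} {β : HBeta}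
    {cr : ℝ} (hW : ∀ k (v : Fin (k + 1) → ℝ), v ∈ Box γ k → extd v ∈ W)
    (hA : RepresentsA EA rA γ β) (hB : RepresentsB EBfam rB γ β)
    (h𝒜A : ∀ g' ∈ W, EA g' ∈ 𝒜A) (h𝒜B : ∀ b', 0 < b' → b' ≤ γ → ∀ g' ∈ W, EBfam b' g' ∈ 𝒜B)
    (hr : ReadBoundedOn 𝒜A rA κ cr) (hcov : ReadCovariantOn 𝒜A 𝒜B rA rB κ cr) (hcr : 0 ≤ cr)
    -- ===== node U1/H3's runs, the rates and the window =====
    {ρ : ℝ} {g : ℕ → ℕ → ℝ} (gIR : ℝ) (hθ₅ρ : θ₅ ≤ ρ) (hνρ : ν < ρ) (hρ0 : 0 < ρ) (hρ1 : ρ < 1) (hγ : 0 ≤ γ)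
    (hrun : ∀ K, RGEqH K β (g K)) (hbox : ∀ K i, i ≤ K → 0 < g K i ∧ g K i ≤ γ) (hpin : ∀ K, g K K = gIR)
    (hsmall : cr * (ℓ / ν) * ν * (γ ^ 3 / 2) * (ρ / (ρ - ν)) ≤ (1 - ρ) / 2)
    (hgA : ∀ K, g K ∈ W) (hgB : ∀ K, (fun i => g (K + 1) (i + 1)) ∈ W)
    -- ===== node U1b, nodes U5/U6, the target rate =====
    {R : Readings ι X} {C₃ θ₃ P θ' : ℝ} {q : ℕ} {CU : (ℕ → ℝ) → ℕ → ℝ} {uA : ℕ → ι → C.BgA} {uB : ℕ → ι → C.BgB}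
    (hU : LipBackground EA W κ CU) (hG : PolyLipGrowth CU g P q) (hP : 0 ≤ P)
    (hloc : LocalRate R C₃ θ₃) (hC₃ : 0 ≤ C₃) (hθ₃ : 0 ≤ θ₃) (hθ₃1 : θ₃ < 1) (hgd : GaugeDominated R uA uB)
    (hθ' : max ν ρ < θ') (hθ₅' : θ₅ ≤ θ') (hθ₃' : θ₃ ≤ θ') :
    ∃ a : ℝ, 0 ≤ a ∧ ∀ K, URateUpTo K EA EB (g K) (fun i => g (K + 1) (i + 1)) (uA K) (uB K) R.dom
      (a + ℓ / ν * (γ ^ 3 * (2 * (cr * C₅ * θ₅) / (1 - ρ))) * (θ' / (θ' - max ν ρ)) + C₅) θ' κ := by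
  subst hℓ hν hC₅
  have hK := ne9_and_fadingMemory_of_couplingTwoPoint G ρT expl h0 hAdm hres hadd hsum hstep hfac hclip0 hCup hqT0 hTcup
    hrepr hexpl hclipb hpexb hpexbar hqTb hKP hdec hpinB hρT hocc hB0 hlipb hτbar hω hpos hτ
  have hC₅nn := ne5Const_nonneg hΛ₅ hδ₅ hr₀ hc₁ hc₅ hB₅ hsmall5
  have h5 := ne5_at_of_entrywise_lip_nat M hrA hrB hbase hlip5 hdA hdB hent hunit hfl hr₀ hc₁ hins hdamp hΛ₅ hδ₅ hθ₁
    hθ₁₅ hθ₅1 hc₅ hω₅ hnear hB₅ hfirst hsmall5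
  have hinj := injectedRate_of_endNE9_endNE5 G Mf ρT expl h0 hAdm hres hadd hsum hstep hfac hclip0 hCup hqT0 hTcup hrepr
    hexpl hclipb hpexb hpexbar hqTb hKP hdec hpinB hρT hocc hB0 hlipb hτbar hω hpos hτ rfl rfl hdA hunit hr₀ hc₁ hrAf hrBf
    hbasef hlipf hdBf hentf hflf hinsf hdampf hΛ₅ hδ₅ hθ₁ hθ₁₅ hθ₅1 hc₅ hω₅ hnear hB₅ hfirst hsmall5 rfl hW hA hB h𝒜A h𝒜B
    hr hcov hcr g gIR hθ₅ρ hνρ hρ0 hρ1 hγ hrun hbox hpin hsmall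
  exact uRateUpTo_of_nodes hK.1 hK.2 hpos.le hU hG hP h5 (hθ₁.trans hθ₁₅) hC₅nn hloc hC₃ hθ₃ hθ₃1 hgd hinj
    (div_nonneg (mul_nonneg zero_le_two (mul_nonneg (mul_nonneg hcr hC₅nn) (hθ₁.trans hθ₁₅))) (by linarith)) hρ0.le
    hbox hgA hgB hθ' hθ₅' hθ₃'

end Summit.QuantumFields.BalabanUV.T4Continuum.NE4ReadOutSocket
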